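import Summits.ResolutionOfSingularities.ResolutionOfSingularities.Theorems.FrobeniusClosingSteerHevLeafMax
import Summits.ResolutionOfSingularities.ResolutionOfSingularities.Theorems.FrobeniusClosingSteerArithReductionLegality
import Summits.ResolutionOfSingularities.ResolutionOfSingularities.Theorems.FrobeniusClosingSteerVisitLawDelta
import Summits.ResolutionOfSingularities.ResolutionOfSingularities.Theorems.FrobeniusClosingSteerWords18HeightVocab
import HarnessLib

/-!
# hARᵒ — the THREE LEAF WORDS, word-checked and typed (res-L0-w41-strat-2 g3; RULING 251 (i) «strat-2 WORD-CHECK (primary)»;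
  answer to res-D-repro-2 g9 18:34:41Z REMAINING LIST (3); SIGNATURES + PROVED leaf; 0 sorries)

VERDICT IN ONE LINE: **H2′ and Hγ PASS in the shapes below; `LatePointStepsRational` is NOT a T-line word (RULING 185f stands: false-able,
undischargeable) — the non-rational windows enter LATER as a RESIDUE word in the hNRW pattern, attached to the GLUE, not to the leaf.**

The leaf the holder needs replaces the skeleton word hARᵒ `StrippingTailSwitchingOddArithTwoN` (r50 l.3226, restated VERBATIM below for the
composability proof) by words consumed BY NAME through the tree assembly
`ArithReductionLegality.H3_of_pieces` (p540077-era, landed) + `VisitLawDelta.hS1a_of_run` (p544279 ✓) + `ArithReduction.exists_bound_of_not_infinite_posStepTwo`: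

* (HYG) `ArithRunHygieneTwoN` — run hygiene beyond a bound: members regular of dimension 4, no singular primes of height 0 / 1 at late point
  steps (N4). NOT a crux: dischargeable BY NAME from `steeredMembersRegular_holds`, `runHygieneTwo_holds` / `ringKrullDim_member_eq` and (N4)
  `NoSingularCarrier.noSingularCarrier_along_run` with res-L0-w41-strat-1ʼs `memberFrobeniusCongruence_two` (ShadowVacuous §2–§3) — the hunk author
  may discharge it inline instead of carrying the word; it is a word here only so that the leaf elaborates today.
* (W-Hγ) `EventuallyOnlyExcStripsTwoN` — S1c of RULING 145: beyond a bound, between the two members of a visit pair of the tracked exceptional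
  parameter `x` EVERY step is the `x`-strip. Conclusion = the `HΓ` binder of `hS1a_of_run` VERBATIM (so the leaf feeds it by name). Hygiene as hypotheses.
* (W-S1b) `EventuallyConstantReducedOrderTwoN` — slot 072: the run reaches tri-1ʼs `EventuallyConstantReducedOrder R P s p` (constant odd reduced
  order `d ≥ 3` at late point steps, A-stages recur). Hygiene + HΓ as hypotheses.
* (W-H2′) `LateSwitchBinaryAStageTwoN` — H2-DESIGN §1 RELAXED shape («∀ i₀, ∃ A-stage i ≥ i₀ with an ON-AXIS binary datum and its exceptional
  parameter u»), under hygiene + HΓ + the S1b data `(d, i₁)` as hypotheses; NO rationality hypothesis (185f). This is exactly what repro-2ʼs GLUE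
  `…ArithReductionH2` produces from F3ʳᵘⁿ/F4ʳᵘⁿ/Fβʳᵘⁿ in the rational-window case; the non-rational windows are the GLUEʼs residue word (below), not the leafʼs.
* LEAF (PROVED, 60 l.): `oddArith_of_words : ArithRunHygieneTwoN → EventuallyOnlyExcStripsTwoN → EventuallyConstantReducedOrderTwoN →
  LateSwitchBinaryAStageTwoN → StrippingTailSwitchingOddArithTwoN` — G2 («relaxed glue») is INLINED: a residue zero at a late on-axis binary A-stage
  gives a later height-≥2 positive step (`H3_of_pieces`), impossible beyond the `¬ HeightTwoStepsInfinite` bound.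

WHY NOT `LatePointStepsRational`: as a hypothesis-word on the T-line it asserts «late point steps are residually rational», which FAILS for runs whose
residue tower `κ(R i)` climbs to an infinite algebraic `κ(O)/k` (non-Abhyankar `O` — in scope by `CoreDatum`); T would then be proved modulo a false-able
word. The hNRW precedent (`NoTangentialStepNonRationalTwo`, r50 l.4570) is the right pattern: the GLUE proves
`lateSwitchBinaryAStageTwoN_of_residue : SwitchWindowNonRationalArithTwo → … → LateSwitchBinaryAStageTwoN`, where the residue word = the glueʼs own
window statement with «one of the windows is NOT residually rational» as hypothesis and the SAME on-axis binary output (chain-level binders VERBATIM from the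
run wrappers, as hNRW copies `noTangentialStepPerfect_of_rational`ʼs); its discharge = the étale base-change / support-space descent of 185f (lib-1ʼs K3
infrastructure, one file three consumers). Until the glue lands, W-H2′ rides the T-line as the WORK binder; then the hoist swaps hH2′ ↦ (glue hNRA …).
OURS; candidates, not facts.
-/

-- `Summit.<S>.<S>.…` duplicates the summit name by design (single-problem summit).
set_option linter.dupNamespace false

open IsLocalRing
open Literature.AlgebraicGeometry.Resolution
open Summit.ResolutionOfSingularities.ResolutionOfSingularities.Theorems.SwitchingDichotomy.Words
open Summit.ResolutionOfSingularities.ResolutionOfSingularities.Theorems.SteerRankThinness (Concl HasProperCoarsening)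
open Summit.ResolutionOfSingularities.ResolutionOfSingularities.Theorems.SwitchingDichotomy.ArithReduction
open Summit.ResolutionOfSingularities.ResolutionOfSingularities.Theorems.SwitchingDichotomy

namespace Summit.ResolutionOfSingularities.ResolutionOfSingularities.Theorems.SwitchingDichotomy.ArithLeaf

variable {K : Type} [Field K]

/-- hARᵒ `StrippingTailSwitchingOddArithTwoN` — RESTATED VERBATIM from the skeleton of record r50 `Steer_r50.lean` 19bb4465e42febe9 l.3226–3245
(the skeleton decl is not importable; the hunk proves the skeleton word by `exact` through this one or re-runs the leaf proof). OURS. (folklore) -/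
def StrippingTailSwitchingOddArithTwoN : Prop :=
  ∀ p : ℕ, p = 2 →
    ∀ (k K : Type) [Field k] [CharP k p] [PerfectField k] [Field K] [Algebra k K]
    (O : ValuationSubring K) (A₀ : Subalgebra k K) (h₀ : A₀.toSubring ≤ O.toSubring) (t : K),
    CoreDatum p 4 k K O A₀ h₀ t → ¬ HasProperCoarsening O →
    ∀ (R : ℕ → Subring K) (P : (i : ℕ) → Ideal (R i)) (s : ℕ → K),
      R 0 = locAtCentre A₀.toSubring O → NormalAt O (R 0) p t → IsSteeredRun O R P t p s →
      (¬ ∃ i₀ c : ℕ, 1 ≤ c ∧ IsDominantTail R P i₀ c) →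
      (∃ i₀ : ℕ, ∀ i, i₀ ≤ i → IsHighOrderAt R s p i) →
      ¬ HeightTwoStepsInfinite R P → {j | IsPosStep R P j}.Infinite →
      (∀ i₀ : ℕ, ∃ i, i₀ ≤ i ∧ IsPointStep R P i ∧
        ∀ hs : s i ^ p ∈ R i, ¬ HasIsolatedSingularity (RadicandRing (R i) p ⟨s i ^ p, hs⟩)) →
      (¬ ∃ i₀ : ℕ, ∃ x : K, x ≠ 0 ∧ x ∈ O ∧ O.valuation x < 1 ∧
        ∀ i, i₀ ≤ i → ∀ y ∈ R i, O.valuation y < 1 → ∃ j, i < j ∧ y / x ∈ R j) →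
      (∀ i₀ : ℕ, ∃ i, i₀ ≤ i ∧ OddCleanedPointStepAt R P s p i) →
      ArithSwitchClause R P s p

/-- **(HYG) `ArithRunHygieneTwoN`** — run hygiene in the shapes `H3_of_pieces` / `hS1a_of_run` / F3ʳᵘⁿ consume: every member regular of Krull
dimension `4`; beyond a bound `N₁`, no singular prime of height `0` or `1` of the radicand at a point step (N4). By-name dischargeable (header); a word
here only so that the leaf elaborates. OURS. (folklore) -/
def ArithRunHygieneTwoN : Prop :=
  ∀ p : ℕ, p = 2 →
    ∀ (k K : Type) [Field k] [CharP k p] [PerfectField k] [Field K] [Algebra k K]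
    (O : ValuationSubring K) (A₀ : Subalgebra k K) (h₀ : A₀.toSubring ≤ O.toSubring) (t : K),
    CoreDatum p 4 k K O A₀ h₀ t → ¬ HasProperCoarsening O →
    ∀ (R : ℕ → Subring K) (P : (i : ℕ) → Ideal (R i)) (s : ℕ → K),
      R 0 = locAtCentre A₀.toSubring O → NormalAt O (R 0) p t → IsSteeredRun O R P t p s →
      ∃ N₁ : ℕ, (∀ i, IsRegularLocalRing (R i)) ∧ (∀ i, ringKrullDim (R i) = (4 : ℕ)) ∧
        (∀ j, N₁ ≤ j → IsPointStep R P j → ∀ (hs' : s j ^ p ∈ R j) (Q : Ideal (R j)) [Q.IsPrime], Q.height = 0 →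
          ¬ SigmaTopLegality.IsSingPrime (R j) p ⟨s j ^ p, hs'⟩ Q) ∧
        (∀ j, N₁ ≤ j → IsPointStep R P j → ∀ (hs' : s j ^ p ∈ R j) (Q : Ideal (R j)) [Q.IsPrime], Q.height = 1 →
          ¬ SigmaTopLegality.IsSingPrime (R j) p ⟨s j ^ p, hs'⟩ Q)

/-- **(W-Hγ) `EventuallyOnlyExcStripsTwoN`** (S1c, RULING 145) — hARᵒʼs binders + hygiene ⇒ beyond a bound, for every visit pair `j < j'` of an
exceptional parameter `x` of the step at `j`, EVERY step strictly between is the strip along `V(x)` (`P l = (x)`). Conclusion = the `HΓ` binder of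
`VisitLawDelta.hS1a_of_run` VERBATIM. Why it might fail: a singular divisor of clord ≥ 2 through the centre made permissible by a point step (RULING 145ʼs
`b·(a²+b³)²`) gives early non-`x` strips — «eventually» rests on the clord count (finitely many such divisors, each non-`x` strip lowers a clord by 2).
OURS. (folklore) -/
def EventuallyOnlyExcStripsTwoN : Prop :=
  ∀ p : ℕ, p = 2 →
    ∀ (k K : Type) [Field k] [CharP k p] [PerfectField k] [Field K] [Algebra k K]
    (O : ValuationSubring K) (A₀ : Subalgebra k K) (h₀ : A₀.toSubring ≤ O.toSubring) (t : K),
    CoreDatum p 4 k K O A₀ h₀ t → ¬ HasProperCoarsening O →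
    ∀ (R : ℕ → Subring K) (P : (i : ℕ) → Ideal (R i)) (s : ℕ → K),
      R 0 = locAtCentre A₀.toSubring O → NormalAt O (R 0) p t → IsSteeredRun O R P t p s →
      (¬ ∃ i₀ c : ℕ, 1 ≤ c ∧ IsDominantTail R P i₀ c) →
      (∃ i₀ : ℕ, ∀ i, i₀ ≤ i → IsHighOrderAt R s p i) →
      ¬ HeightTwoStepsInfinite R P → {j | IsPosStep R P j}.Infinite →
      (∀ i₀ : ℕ, ∃ i, i₀ ≤ i ∧ IsPointStep R P i ∧
        ∀ hs : s i ^ p ∈ R i, ¬ HasIsolatedSingularity (RadicandRing (R i) p ⟨s i ^ p, hs⟩)) →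
      (¬ ∃ i₀ : ℕ, ∃ x : K, x ≠ 0 ∧ x ∈ O ∧ O.valuation x < 1 ∧
        ∀ i, i₀ ≤ i → ∀ y ∈ R i, O.valuation y < 1 → ∃ j, i < j ∧ y / x ∈ R j) →
      (∀ i₀ : ℕ, ∃ i, i₀ ≤ i ∧ OddCleanedPointStepAt R P s p i) →
      (∀ i, IsRegularLocalRing (R i)) → (∀ i, ringKrullDim (R i) = (4 : ℕ)) →
      ∀ N₁ : ℕ,
      (∀ j, N₁ ≤ j → IsPointStep R P j → ∀ (hs' : s j ^ p ∈ R j) (Q : Ideal (R j)) [Q.IsPrime], Q.height = 0 →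
          ¬ SigmaTopLegality.IsSingPrime (R j) p ⟨s j ^ p, hs'⟩ Q) →
      (∀ j, N₁ ≤ j → IsPointStep R P j → ∀ (hs' : s j ^ p ∈ R j) (Q : Ideal (R j)) [Q.IsPrime], Q.height = 1 →
          ¬ SigmaTopLegality.IsSingPrime (R j) p ⟨s j ^ p, hs'⟩ Q) →
      ∃ N₂ : ℕ, ∀ (j j' : ℕ) (x : K), N₂ ≤ j → IsVisitPair R P j j' →
        ((∃ h : x ∈ R j, (⟨x, h⟩ : R j) ∈ P j) ∧ x ≠ 0 ∧ ∀ y : R j, y ∈ P j → O.valuation (y : K) ≤ O.valuation x) →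
        ∀ l, j < l → l < j' → ∃ hx : x ∈ R l, P l = Ideal.span {(⟨x, hx⟩ : R l)}

/-- **(W-S1b) `EventuallyConstantReducedOrderTwoN`** (slot 072) — hARᵒʼs binders + hygiene + HΓ ⇒ tri-1ʼs `EventuallyConstantReducedOrder R P s p`
(`…Words12MemberDatum` l.116: constant odd reduced order `d ≥ 3` at late point steps and A-stages recur). Why it might fail: the reduced order is not
monotone across non-equimultiple surface strips (tri-3 R-AG climbs) — the count must run on point steps/visits only; A-stage recurrence needs the Fβ
alternation (after a B-visit with `x` exceptional the next visit is an A-stage). OURS. (folklore) -/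
def EventuallyConstantReducedOrderTwoN : Prop :=
  ∀ p : ℕ, p = 2 →
    ∀ (k K : Type) [Field k] [CharP k p] [PerfectField k] [Field K] [Algebra k K]
    (O : ValuationSubring K) (A₀ : Subalgebra k K) (h₀ : A₀.toSubring ≤ O.toSubring) (t : K),
    CoreDatum p 4 k K O A₀ h₀ t → ¬ HasProperCoarsening O →
    ∀ (R : ℕ → Subring K) (P : (i : ℕ) → Ideal (R i)) (s : ℕ → K),
      R 0 = locAtCentre A₀.toSubring O → NormalAt O (R 0) p t → IsSteeredRun O R P t p s →
      (¬ ∃ i₀ c : ℕ, 1 ≤ c ∧ IsDominantTail R P i₀ c) →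
      (∃ i₀ : ℕ, ∀ i, i₀ ≤ i → IsHighOrderAt R s p i) →
      ¬ HeightTwoStepsInfinite R P → {j | IsPosStep R P j}.Infinite →
      (∀ i₀ : ℕ, ∃ i, i₀ ≤ i ∧ IsPointStep R P i ∧
        ∀ hs : s i ^ p ∈ R i, ¬ HasIsolatedSingularity (RadicandRing (R i) p ⟨s i ^ p, hs⟩)) →
      (¬ ∃ i₀ : ℕ, ∃ x : K, x ≠ 0 ∧ x ∈ O ∧ O.valuation x < 1 ∧
        ∀ i, i₀ ≤ i → ∀ y ∈ R i, O.valuation y < 1 → ∃ j, i < j ∧ y / x ∈ R j) →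
      (∀ i₀ : ℕ, ∃ i, i₀ ≤ i ∧ OddCleanedPointStepAt R P s p i) →
      (∀ i, IsRegularLocalRing (R i)) → (∀ i, ringKrullDim (R i) = (4 : ℕ)) →
      ∀ N₁ : ℕ,
      (∀ j, N₁ ≤ j → IsPointStep R P j → ∀ (hs' : s j ^ p ∈ R j) (Q : Ideal (R j)) [Q.IsPrime], Q.height = 0 →
          ¬ SigmaTopLegality.IsSingPrime (R j) p ⟨s j ^ p, hs'⟩ Q) →
      (∀ j, N₁ ≤ j → IsPointStep R P j → ∀ (hs' : s j ^ p ∈ R j) (Q : Ideal (R j)) [Q.IsPrime], Q.height = 1 →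
          ¬ SigmaTopLegality.IsSingPrime (R j) p ⟨s j ^ p, hs'⟩ Q) →
      (∀ (j j' : ℕ) (x : K), N₁ ≤ j → IsVisitPair R P j j' →
        ((∃ h : x ∈ R j, (⟨x, h⟩ : R j) ∈ P j) ∧ x ≠ 0 ∧ ∀ y : R j, y ∈ P j → O.valuation (y : K) ≤ O.valuation x) →
        ∀ l, j < l → l < j' → ∃ hx : x ∈ R l, P l = Ideal.span {(⟨x, hx⟩ : R l)}) →
      EventuallyConstantReducedOrder R P s p

/-- **(W-H2′) `LateSwitchBinaryAStageTwoN`** (H2-DESIGN §1 relaxed shape; tri-1 RULING-REPLY 15:06:01Z «window i ≥ i₀») — hARᵒʼs binders + hygiene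
+ HΓ + the S1b data `(d, i₁)` ⇒ beyond every stage an A-STAGE `i` of cleaned order `d` with an ON-AXIS binary datum: `s i² − g² − Ψ(m₁, m₂) ∈ 𝔪^(d+1)`,
`(m₁, m₂)` part of a r.s.o.p., `Ψ` a form of degree `d`, and an exceptional parameter `u` of the step at `i` with `v m₁ < v u`, `v m₂ < v u`. NO rationality
hypothesis (RULING 185f): the rational-window case is repro-2ʼs F3ʳᵘⁿ/F4ʳᵘⁿ/Fβʳᵘⁿ + H2ₘ; the non-rational windows are the GLUEʼs residue word. Why it might
fail: a late switch configuration both of whose windows are residually non-rational with the support-space descent losing on-axis-ness (185f says it does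
not: on-axis is automatic); H2ₘʼs case split (α)/(β) missing a configuration (Fβ alternation covers it). OURS. (folklore) -/
def LateSwitchBinaryAStageTwoN : Prop :=
  ∀ p : ℕ, p = 2 →
    ∀ (k K : Type) [Field k] [CharP k p] [PerfectField k] [Field K] [Algebra k K]
    (O : ValuationSubring K) (A₀ : Subalgebra k K) (h₀ : A₀.toSubring ≤ O.toSubring) (t : K),
    CoreDatum p 4 k K O A₀ h₀ t → ¬ HasProperCoarsening O →
    ∀ (R : ℕ → Subring K) (P : (i : ℕ) → Ideal (R i)) (s : ℕ → K),
      R 0 = locAtCentre A₀.toSubring O → NormalAt O (R 0) p t → IsSteeredRun O R P t p s →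
      (¬ ∃ i₀ c : ℕ, 1 ≤ c ∧ IsDominantTail R P i₀ c) →
      (∃ i₀ : ℕ, ∀ i, i₀ ≤ i → IsHighOrderAt R s p i) →
      ¬ HeightTwoStepsInfinite R P → {j | IsPosStep R P j}.Infinite →
      (∀ i₀ : ℕ, ∃ i, i₀ ≤ i ∧ IsPointStep R P i ∧
        ∀ hs : s i ^ p ∈ R i, ¬ HasIsolatedSingularity (RadicandRing (R i) p ⟨s i ^ p, hs⟩)) →
      (¬ ∃ i₀ : ℕ, ∃ x : K, x ≠ 0 ∧ x ∈ O ∧ O.valuation x < 1 ∧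
        ∀ i, i₀ ≤ i → ∀ y ∈ R i, O.valuation y < 1 → ∃ j, i < j ∧ y / x ∈ R j) →
      (∀ i₀ : ℕ, ∃ i, i₀ ≤ i ∧ OddCleanedPointStepAt R P s p i) →
      (∀ i, IsRegularLocalRing (R i)) → (∀ i, ringKrullDim (R i) = (4 : ℕ)) →
      ∀ N₁ : ℕ,
      (∀ j, N₁ ≤ j → IsPointStep R P j → ∀ (hs' : s j ^ p ∈ R j) (Q : Ideal (R j)) [Q.IsPrime], Q.height = 0 →
          ¬ SigmaTopLegality.IsSingPrime (R j) p ⟨s j ^ p, hs'⟩ Q) →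
      (∀ j, N₁ ≤ j → IsPointStep R P j → ∀ (hs' : s j ^ p ∈ R j) (Q : Ideal (R j)) [Q.IsPrime], Q.height = 1 →
          ¬ SigmaTopLegality.IsSingPrime (R j) p ⟨s j ^ p, hs'⟩ Q) →
      (∀ (j j' : ℕ) (x : K), N₁ ≤ j → IsVisitPair R P j j' →
        ((∃ h : x ∈ R j, (⟨x, h⟩ : R j) ∈ P j) ∧ x ≠ 0 ∧ ∀ y : R j, y ∈ P j → O.valuation (y : K) ≤ O.valuation x) →
        ∀ l, j < l → l < j' → ∃ hx : x ∈ R l, P l = Ideal.span {(⟨x, hx⟩ : R l)}) →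
      ∀ (d i₁ : ℕ), Odd d → 3 ≤ d →
      (∀ i, i₁ ≤ i → IsPointStep R P i → HasReducedOrderAt R s p i d) →
      (∀ i₀, ∃ i, i₀ ≤ i ∧ IsAStageAt R P s p i d) →
      ∀ i₀ : ℕ, ∃ i, i₀ ≤ i ∧ IsAStageAt R P s p i d ∧
        ∃ (_ : IsLocalRing (R i)) (hs : s i ^ p ∈ R i) (g m₁ m₂ : R i) (Ψ : MvPolynomial (Fin 2) (R i)) (u : K),
          IsRsopPart ![m₁, m₂] ∧ Ψ.IsHomogeneous d ∧
          (⟨s i ^ p, hs⟩ : R i) - g ^ 2 - MvPolynomial.eval ![m₁, m₂] Ψ ∈ maximalIdeal (R i) ^ (d + 1) ∧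
          ((∃ hu : u ∈ R i, (⟨u, hu⟩ : R i) ∈ P i) ∧ u ≠ 0 ∧ ∀ y : R i, y ∈ P i → O.valuation (y : K) ≤ O.valuation u) ∧
          O.valuation (m₁ : K) < O.valuation u ∧ O.valuation (m₂ : K) < O.valuation u

/-- At a late stage, HIGH ORDER forces every cleaned order to be `≥ 2` (indeed `≥ 3`): the bridge between `hS1a_of_run`ʼs `2 ≤ ν →` clause and the
ν-free `hS1a` shape of `H3_of_pieces` / `arithSwitchClause_of_H2`. OURS. (folklore) -/
theorem two_le_of_isHighOrderAt_of_hasCleanedOrderAt {R : ℕ → Subring K} {s : ℕ → K} {j ν : ℕ}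
    (hhigh : IsHighOrderAt R s 2 j) (hclean : HasCleanedOrderAt R s 2 j ν) : 2 ≤ ν := by
  obtain ⟨_, hs, g, hg⟩ := hhigh
  obtain ⟨_, hs', -, hex⟩ := hclean
  by_contra hlt
  have h3 : ν + 1 ≤ 2 + 1 := by omega
  exact hex g (Ideal.pow_le_pow_right h3 hg)

/-- **THE LEAF (PROVED): hARᵒ ⟸ (HYG) ∧ (W-Hγ) ∧ (W-S1b) ∧ (W-H2′)** — over `VisitLawDelta.hS1a_of_run`, `ArithReductionLegality.H3_of_pieces` and
`ArithReduction.exists_bound_of_not_infinite_posStepTwo`; G2 inlined (a residue zero at a late on-axis binary A-stage ⇒ a later positive step of height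
≥ 2 ⇒ contradiction beyond the `¬ HeightTwoStepsInfinite` bound). The skeleton hunk is this proof with the skeletonʼs hARᵒ decl as the goal. OURS. (folklore) -/
theorem oddArith_of_words (hHyg : ArithRunHygieneTwoN) (hγ : EventuallyOnlyExcStripsTwoN)
    (hS1b : EventuallyConstantReducedOrderTwoN) (hH2 : LateSwitchBinaryAStageTwoN) :
    StrippingTailSwitchingOddArithTwoN := by
  intro p hp2 k K _ _ _ _ _ O A₀ h₀ t core hrk R P s hR0 hN hrun hnd hhigh h2inf hinf hwild hnp hodd
  subst hp2
  haveI : CharP K 2 := charP_of_injective_algebraMap (algebraMap k K).injective 2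
  classical
  -- hygiene
  obtain ⟨N₄, hreg, hdim, h0, h1⟩ := hHyg 2 rfl k K O A₀ h₀ t core hrk R P s hR0 hN hrun
  -- high order bound
  obtain ⟨iₕ, hhi⟩ := hhigh
  -- a common bound for hygiene and high order
  have h0' : ∀ j, max N₄ iₕ ≤ j → IsPointStep R P j → ∀ (hs' : s j ^ 2 ∈ R j) (Q : Ideal (R j)) [Q.IsPrime],
      Q.height = 0 → ¬ SigmaTopLegality.IsSingPrime (R j) 2 ⟨s j ^ 2, hs'⟩ Q :=
    fun j hj => h0 j (le_of_max_le_left hj)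
  have h1' : ∀ j, max N₄ iₕ ≤ j → IsPointStep R P j → ∀ (hs' : s j ^ 2 ∈ R j) (Q : Ideal (R j)) [Q.IsPrime],
      Q.height = 1 → ¬ SigmaTopLegality.IsSingPrime (R j) 2 ⟨s j ^ 2, hs'⟩ Q :=
    fun j hj => h1 j (le_of_max_le_left hj)
  -- strips (W-Hγ) beyond `N₂ ≥ max N₄ iₕ` (re-based so that one bound serves all consumers)
  obtain ⟨N₂', hΓ'⟩ := hγ 2 rfl k K O A₀ h₀ t core hrk R P s hR0 hN hrun hnd ⟨iₕ, hhi⟩ h2inf hinf hwild hnp hodd hreg hdim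
    (max N₄ iₕ) h0' h1'
  set N₂ := max (max N₄ iₕ) N₂' with hN₂
  have hΓ : ∀ (j j' : ℕ) (x : K), N₂ ≤ j → IsVisitPair R P j j' →
      ((∃ h : x ∈ R j, (⟨x, h⟩ : R j) ∈ P j) ∧ x ≠ 0 ∧ ∀ y : R j, y ∈ P j → O.valuation (y : K) ≤ O.valuation x) →
      ∀ l, j < l → l < j' → ∃ hx : x ∈ R l, P l = Ideal.span {(⟨x, hx⟩ : R l)} :=
    fun j j' x hj => hΓ' j j' x (le_of_max_le_right hj)
  have h0'' : ∀ j, N₂ ≤ j → IsPointStep R P j → ∀ (hs' : s j ^ 2 ∈ R j) (Q : Ideal (R j)) [Q.IsPrime],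
      Q.height = 0 → ¬ SigmaTopLegality.IsSingPrime (R j) 2 ⟨s j ^ 2, hs'⟩ Q :=
    fun j hj => h0' j (le_of_max_le_left hj)
  have h1'' : ∀ j, N₂ ≤ j → IsPointStep R P j → ∀ (hs' : s j ^ 2 ∈ R j) (Q : Ideal (R j)) [Q.IsPrime],
      Q.height = 1 → ¬ SigmaTopLegality.IsSingPrime (R j) 2 ⟨s j ^ 2, hs'⟩ Q :=
    fun j hj => h1' j (le_of_max_le_left hj)
  -- S1b data (W-S1b)
  obtain ⟨d, i₁, hd, h3, hred, hA⟩ := hS1b 2 rfl k K O A₀ h₀ t core hrk R P s hR0 hN hrun hnd ⟨iₕ, hhi⟩ h2inf hinf hwild hnp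
    hodd hreg hdim N₂ h0'' h1'' hΓ
  -- the relaxed H2′ (W-H2′)
  have hH2' := hH2 2 rfl k K O A₀ h₀ t core hrk R P s hR0 hN hrun hnd ⟨iₕ, hhi⟩ h2inf hinf hwild hnp hodd hreg hdim N₂ h0'' h1'' hΓ
    d i₁ hd h3 hred hA
  -- (S1a) from the run (tree), in the ν-free shape `H3_of_pieces` consumes
  have hdom0 : SubringDominates (R 0) O.toSubring := by
    rw [hR0]
    exact subringDominates_locAtCentre h₀
  have hS1a := VisitLawDelta.hS1a_of_run hrun hdom0 hreg h1'' hΓ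
  have hS1a' : ∀ (j j' : ℕ) (x : K) (ν : ℕ), N₂ ≤ j → IsVisitPair R P j j' →
      ((∃ hx : x ∈ R j, (⟨x, hx⟩ : R j) ∈ P j) ∧ x ≠ 0 ∧ ∀ y : R j, y ∈ P j → O.valuation (y : K) ≤ O.valuation x) →
      HasCleanedOrderAt R s 2 j ν →
      R j' = R (j + 1) ∧ ∃ G W : K, G ∈ R j' ∧ W ∈ R j' ∧ W⁻¹ ∈ R j' ∧ W ≠ 0 ∧ s j' * x ^ (ν / 2) * W = s j - G :=
    fun j j' x ν hj hv hx hclean =>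
      hS1a j j' x ν hj hv hx
        (two_le_of_isHighOrderAt_of_hasCleanedOrderAt (hhi j (le_of_max_le_right (le_of_max_le_left hj))) hclean) hclean
  -- point steps recur
  have hrec : ∀ i₀, ∃ i, i₀ ≤ i ∧ IsPointStep R P i := fun i₀ => by
    obtain ⟨i, hi, hAi⟩ := hA i₀
    exact ⟨i, hi, hAi.1⟩
  -- lateness: beyond `N₃` every positive step has height `< 2`
  -- (`Words.HeightTwoStepsInfinite` / `Words.IsPosStep` vs `SigmaTopLegality.IsPosStep`: VERBATIM twins, equal by `rfl`)
  obtain ⟨N₃, hlate⟩ := ArithReduction.exists_bound_of_not_infinite_posStepTwo (R := R) (P := P) (fun h => h2inf h)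
  -- (H3) from the pieces, beyond `N₂`
  have hH3 := ArithReductionLegality.H3_of_pieces hrun hdom0 hrec hS1a' hreg (n := 4) (by norm_num) hdim h0'' h1'' hd
  -- the arithmetic switch clause
  refine ⟨d, hd, h3, fun i₀ => ?_⟩
  obtain ⟨i, hi, hAi, hloc, hs, g, m₁, m₂, Ψ, u, hrsop, hhom, hcong, hu, hm₁, hm₂⟩ := hH2' (max i₀ (max N₂ N₃))
  have hi₀ : i₀ ≤ i := le_of_max_le_left hi
  have hN₂i : N₂ ≤ i := le_of_max_le_left (le_of_max_le_right hi)
  have hN₃i : N₃ ≤ i := le_of_max_le_right (le_of_max_le_right hi)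
  refine ⟨i, hi₀, hAi.1, hloc, hs, g, m₁, m₂, Ψ, hrsop, hhom, hcong, ?_⟩
  intro a b hab hzero
  obtain ⟨j', hij', hpos, hht⟩ := hH3 i hN₂i hAi hloc hs g m₁ m₂ Ψ u hrsop hhom hcong hu hm₁ hm₂ ⟨a, b, hab, hzero⟩
  exact absurd hht (not_le.mpr (hlate j' (hN₃i.trans hij'.le) hpos))

end Summit.ResolutionOfSingularities.ResolutionOfSingularities.Theorems.SwitchingDichotomy.ArithLeaf
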